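import Summits.Parity.GeneralizedHardyLittlewood.Theorems.LeeYangFibresAbsoluteUpgradeUniformDefs
import Summits.Parity.GeneralizedHardyLittlewood.Theorems.LeeYangFibresAbsoluteUpgradeUniformGrowth
import Summits.Parity.GeneralizedHardyLittlewood.Theorems.LeeYangFibresRelativeDimOneAmplificationAux
import HarnessLib

/-!
# Route `LeeYangFibres`, crux `AbsoluteUpgrade` (stmt-Parity-14116), line `Sketch` (uniform amplification):
# real-variable bookkeeping of the transfer `stub_amplification` (stub F)

Sorry-free auxiliary facts for `LeeYangFibresAbsoluteUpgradeUniformAmplification.lean`, which proves the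
registered stub `stub_amplification : Amplification`
(`UniformSingularMean → CollisionFormFacts → UniformRelativeDimOne → DimOne`, the tensor-power trick over
translate-constellations with a GROWING number `m + 1 = ⌊(log log N)^{t-1}⌋ + 1` of translates). Everything
here is elementary real analysis / finite sums, kept apart so that the main file stays short:

* `one_sub_div_pow_le` — `(1 - 2u/k)^k ≤ 1 - u` for `0 ≤ u ≤ 1/2`, `k ≥ 1`
  (`1 - a ≤ e^{-a}`, `e^{-2u} ≤ 1/(1+2u) ≤ 1 - u`);
* `uniformRoot_abs_sub_le` (registered sub-goal) — ROOT EXTRACTION with the gain `1/k`: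
  `(1-θ)M^k ≤ S^k ≤ (1+θ)M^k`, `0 ≤ θ ≤ 1/2`, `S, M ≥ 0` give `|S - M| ≤ (2θ/k) M`
  (Bernoulli `1 + θ ≤ (1 + θ/k)^k` and the previous item, then monotonicity of `x ↦ x^k` on `ℝ≥0`);
* `uniform_high_mass_amplify` — THE BOOKKEEPING AT HIGH SINGULAR MASS `M ≥ 5N`, over an abstract finite set of
  shifts split into good/bad ones: complete sum `∑_H S_H = S^{m+1}`, averaged main terms
  `∑_{good} M_H = M^{m+1} + O(ε₁(M^{m+1} + N^{m+1}))`, relative bounds `|S_H - M_H| ≤ ε₁(M_H + N)` on the good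
  shifts, `0 ≤ S_H ≤ B` and `#bad · B ≤ ε₁ N^{m+1}` on the bad ones, `#shifts ≤ 5^m N^m`; then
  `(1 - 4ε₁)M^{m+1} ≤ S^{m+1} ≤ (1 + 4ε₁)M^{m+1}` and `|S - M| ≤ (8ε₁/(m+1)) M`;
* `exists_translates` — the schedule `m = ⌊ℓ^{t-1}⌋`, `ℓ = log log N ≥ 2t`: `m ≥ 1`, `ℓ^{t-1} < m + 1`,
  `(m+1)t ≤ ℓ^t`;
* `eventually_degenerate_junk_le` — the degenerate shifts contribute `o(N^{m+1})` UNIFORMLY in the admissible `m`: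
  `m(m+1)t²(4N+1)^{m-1}(2N+1) log^{(m+1)t}(2(3m+1)L₁N) ≤ ε₁ N^{m+1}` for all large `N` and all `m` with
  `(m+1)t ≤ (log log N)^t` (every junk factor is `≤ N^{1/8}` by the toolkit of
  `LeeYangFibresAbsoluteUpgradeUniformGrowth`).

References: B. Green, T. Tao, Ann. of Math. 171 (2010), Conj. 1.2 / 1.4 [GreenTao2010]; T. Tao, V. Vu,
*Additive Combinatorics*, §2 (tensor power trick).
-/

noncomputable section

open scoped BigOperators Classical Topology
open Finset Filter MeasureTheory Literature.NumberTheory.Sieve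
open Summit.Parity.GeneralizedHardyLittlewood.Cruxes.RelativeDimOne.TranslateAmplification

namespace Summit.Parity.GeneralizedHardyLittlewood.Cruxes.AbsoluteUpgrade.UniformAmplification

/-! ### Root extraction with the gain `1/k` -/

/-- `(1 - 2u/k)^k ≤ 1 - u` for `0 ≤ u ≤ 1/2` and `k ≥ 1`: `1 - a ≤ e^{-a}` with `a = 2u/k ∈ [0, 1]`, so
`(1 - a)^k ≤ e^{-2u} ≤ 1/(1 + 2u) ≤ 1 - u` (the last step is `(1 - u)(1 + 2u) = 1 + u - 2u² ≥ 1`). [folklore] -/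
theorem one_sub_div_pow_le {u : ℝ} (hu0 : 0 ≤ u) (hu : u ≤ 1 / 2) {k : ℕ} (hk : 1 ≤ k) :
    (1 - 2 * u / k) ^ k ≤ 1 - u := by
  have hk1 : (1 : ℝ) ≤ k := by exact_mod_cast hk
  have hk0 : (0 : ℝ) < k := by linarith
  have ha1 : 2 * u / k ≤ 1 := by
    rw [div_le_one hk0]
    linarith
  have h1 : 1 - 2 * u / k ≤ Real.exp (-(2 * u / k)) := by
    have := Real.add_one_le_exp (-(2 * u / k))
    linarith
  have h2 : (1 - 2 * u / k) ^ k ≤ Real.exp (-(2 * u / k)) ^ k :=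
    pow_le_pow_left₀ (by linarith) h1 k
  have h3 : Real.exp (-(2 * u / k)) ^ k = Real.exp (-(2 * u)) := by
    rw [← Real.exp_nat_mul]
    congr 1
    field_simp
  have h4 : Real.exp (-(2 * u)) ≤ 1 - u := by
    rw [Real.exp_neg]
    have h5 : 1 + 2 * u ≤ Real.exp (2 * u) := by
      have := Real.add_one_le_exp (2 * u)
      linarith
    have h6 : 0 < 1 + 2 * u := by linarith
    calc (Real.exp (2 * u))⁻¹ ≤ (1 + 2 * u)⁻¹ := inv_anti₀ h6 h5
      _ ≤ 1 - u := by
          rw [inv_eq_one_div, div_le_iff₀ h6]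
          nlinarith
  calc (1 - 2 * u / k) ^ k ≤ Real.exp (-(2 * u / k)) ^ k := h2
    _ = Real.exp (-(2 * u)) := h3
    _ ≤ 1 - u := h4

/-- **ROOT EXTRACTION WITH THE GAIN `1/k`** (registered sub-goal of this auxiliary file): if `S, M ≥ 0`,
`0 ≤ θ ≤ 1/2`, `k ≥ 1` and `(1 - θ) M^k ≤ S^k ≤ (1 + θ) M^k`, then `|S - M| ≤ (2θ/k) M`. Indeed
`1 + θ ≤ (1 + θ/k)^k` (Bernoulli) and `(1 - 2θ/k)^k ≤ 1 - θ` (`one_sub_div_pow_le`), so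
`((1 - 2θ/k)M)^k ≤ S^k ≤ ((1 + θ/k)M)^k`, and `x ↦ x^k` is monotone on `ℝ≥0`. This is where the growing
number of translates divides the relative error. [folklore] -/
theorem uniformRoot_abs_sub_le : ∀ (k : ℕ) (θ S M : ℝ), 1 ≤ k → 0 ≤ θ → θ ≤ 1 / 2 → 0 ≤ S → 0 ≤ M → S ^ k ≤ (1 + θ) * M ^ k → (1 - θ) * M ^ k ≤ S ^ k → |S - M| ≤ 2 * θ / (k : ℝ) * M := by
  intro k θ S M hk hθ0 hθ hS hM hU hL
  have hk0 : k ≠ 0 := by omega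
  have hk1 : (1 : ℝ) ≤ k := by exact_mod_cast hk
  have hkpos : (0 : ℝ) < k := by linarith
  have hPk : 0 ≤ M ^ k := pow_nonneg hM k
  -- upper: Bernoulli
  have hθk : 0 ≤ θ / k := by positivity
  have hB : 1 + θ ≤ (1 + θ / k) ^ k := by
    have h := one_add_mul_le_pow (show (-2 : ℝ) ≤ θ / k by linarith) k
    have h2 : (k : ℝ) * (θ / k) = θ := by field_simp
    rw [h2] at h
    exact h
  have hU' : S ^ k ≤ ((1 + θ / k) * M) ^ k := by
    rw [mul_pow]
    exact hU.trans (mul_le_mul_of_nonneg_right hB hPk)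
  have h1 : S ≤ (1 + θ / k) * M := (pow_le_pow_iff_left₀ hS (by positivity) hk0).mp hU'
  -- lower: `(1 - 2θ/k)^k ≤ 1 - θ`
  have ha : 0 ≤ 1 - 2 * θ / k := by
    have : 2 * θ / k ≤ 1 := by
      rw [div_le_one hkpos]
      linarith
    linarith
  have hL' : ((1 - 2 * θ / k) * M) ^ k ≤ S ^ k := by
    rw [mul_pow]
    exact (mul_le_mul_of_nonneg_right (one_sub_div_pow_le hθ0 hθ hk) hPk).trans hL
  have h2 : (1 - 2 * θ / k) * M ≤ S := (pow_le_pow_iff_left₀ (mul_nonneg ha hM) hS hk0).mp hL'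
  have h3 : θ / k * M ≤ 2 * θ / k * M := by
    apply mul_le_mul_of_nonneg_right _ hM
    exact div_le_div_of_nonneg_right (by linarith) hkpos.le
  have h4 : (1 + θ / k) * M = M + θ / k * M := by ring
  have h5 : (1 - 2 * θ / k) * M = M - 2 * θ / k * M := by ring
  rw [abs_le]
  constructor <;> linarith

/-! ### The tensor-power bookkeeping at high singular mass, uniform in `m` -/

/-- **HIGH SINGULAR MASS, UNIFORM IN THE NUMBER OF TRANSLATES** (`5N ≤ M`). Over a finite set `s` of shifts split
into good (`p`) and bad ones: if `∑_s S_H = S^{m+1}` (complete sum),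
`|∑_{good} M_H - M^{m+1}| ≤ ε₁ (M^{m+1} + N^{m+1})` (averaged main terms),
`|S_H - M_H| ≤ ε₁ (M_H + N)` on good shifts (relative Hardy–Littlewood, uniform in the number of forms),
`0 ≤ S_H ≤ B` with `#bad ≤ CD`, `CD · B ≤ ε₁ N^{m+1}` (few bad shifts), `#s ≤ 5^m N^m` and `ε₁ ≤ 1/8`, then
`(1 - 4ε₁) M^{m+1} ≤ S^{m+1} ≤ (1 + 4ε₁) M^{m+1}` (using `N^{m+1} ≤ M^{m+1}/5^{m+1}`), whence
`|S - M| ≤ (8ε₁/(m+1)) M` by `uniformRoot_abs_sub_le`: the relative error is DIVIDED by the number of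
translates. [folklore] -/
theorem uniform_high_mass_amplify {ι : Type*} (s : Finset ι) (p : ι → Prop) [DecidablePred p]
    (SH MH : ι → ℝ) (m : ℕ) {N : ℕ} {S M ε₁ CD B : ℝ}
    (hε0 : 0 ≤ ε₁) (hε8 : ε₁ ≤ 1 / 8) (hS : 0 ≤ S) (hM : 0 ≤ M) (h5 : 5 * (N : ℝ) ≤ M)
    (hX : ∑ H ∈ s, SH H = S ^ (m + 1))
    (hSig : |∑ H ∈ s.filter p, MH H - M ^ (m + 1)| ≤ ε₁ * (M ^ (m + 1) + (N : ℝ) ^ (m + 1)))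
    (hG : ∀ H ∈ s, p H → |SH H - MH H| ≤ ε₁ * (MH H + N))
    (hDup : ∀ H ∈ s, ¬p H → SH H ≤ B) (hB : 0 ≤ B) (h0 : ∀ H ∈ s, 0 ≤ SH H)
    (hcard : (s.card : ℝ) ≤ 5 ^ m * (N : ℝ) ^ m)
    (hcardD : ((s.filter (fun H => ¬p H)).card : ℝ) ≤ CD)
    (htail : CD * B ≤ ε₁ * (N : ℝ) ^ (m + 1)) :
    |S - M| ≤ 8 * ε₁ / ((m : ℝ) + 1) * M := by
  have hN : (0 : ℝ) ≤ N := Nat.cast_nonneg N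
  have hP0 : 0 ≤ M ^ (m + 1) := pow_nonneg hM _
  have hQ0 : 0 ≤ (N : ℝ) ^ (m + 1) := pow_nonneg hN _
  -- per-term bounds on the good shifts
  have hGup : ∀ H ∈ s, p H → SH H ≤ (1 + ε₁) * MH H + ε₁ * N := fun H hH hp => by
    have h := (abs_le.mp (hG H hH hp)).2
    linarith
  have hGlo : ∀ H ∈ s, p H → (1 - ε₁) * MH H - ε₁ * N ≤ SH H := fun H hH hp => by
    have h := (abs_le.mp (hG H hH hp)).1
    linarith
  -- the complete sum, split along `p`
  have hup := sum_filter_upper s p SH MH hGup hDup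
  have hlo := sum_filter_lower s p SH MH hGlo h0
  rw [hX] at hup hlo
  have hcardG : ((s.filter p).card : ℝ) ≤ 5 ^ m * (N : ℝ) ^ m :=
    le_trans (by exact_mod_cast Finset.card_filter_le s p) hcard
  have hGslack : ((s.filter p).card : ℝ) * (ε₁ * N) ≤ ε₁ * (5 ^ m * (N : ℝ) ^ (m + 1)) :=
    calc ((s.filter p).card : ℝ) * (ε₁ * N) ≤ 5 ^ m * (N : ℝ) ^ m * (ε₁ * N) :=
          mul_le_mul_of_nonneg_right hcardG (by positivity)
      _ = ε₁ * (5 ^ m * (N : ℝ) ^ (m + 1)) := by rw [pow_succ]; ring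
  have hDpart : ((s.filter (fun H => ¬p H)).card : ℝ) * B ≤ ε₁ * (N : ℝ) ^ (m + 1) :=
    (mul_le_mul_of_nonneg_right hcardD hB).trans htail
  -- `5 · 5^m N^{m+1} ≤ M^{m+1}` from `5N ≤ M`
  have h5P : 5 * (5 ^ m * (N : ℝ) ^ (m + 1)) ≤ M ^ (m + 1) := by
    have h := pow_le_pow_left₀ (by positivity) h5 (m + 1)
    rw [mul_pow, pow_succ] at h
    calc 5 * (5 ^ m * (N : ℝ) ^ (m + 1)) = 5 ^ m * 5 * (N : ℝ) ^ (m + 1) := by ring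
      _ ≤ M ^ (m + 1) := h
  have hF : ε₁ * (5 ^ m * (N : ℝ) ^ (m + 1)) ≤ ε₁ * M ^ (m + 1) / 5 := by
    rw [le_div_iff₀ (by norm_num : (0 : ℝ) < 5)]
    have h := mul_le_mul_of_nonneg_left h5P hε0
    linarith
  have hQF : (N : ℝ) ^ (m + 1) ≤ 5 ^ m * (N : ℝ) ^ (m + 1) :=
    le_mul_of_one_le_left hQ0 (one_le_pow₀ (by norm_num))
  have hQ : ε₁ * (N : ℝ) ^ (m + 1) ≤ ε₁ * M ^ (m + 1) / 5 :=
    (mul_le_mul_of_nonneg_left hQF hε0).trans hF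
  -- the averaged main terms, multiplied through
  obtain ⟨hSiglo, hSigup⟩ := abs_le.mp hSig
  have hA : (1 + ε₁) * ∑ H ∈ s.filter p, MH H ≤
      (1 + ε₁) * (M ^ (m + 1) + ε₁ * (M ^ (m + 1) + (N : ℝ) ^ (m + 1))) :=
    mul_le_mul_of_nonneg_left (by linarith) (by linarith)
  have hA' : (1 - ε₁) * (M ^ (m + 1) - ε₁ * (M ^ (m + 1) + (N : ℝ) ^ (m + 1))) ≤
      (1 - ε₁) * ∑ H ∈ s.filter p, MH H :=
    mul_le_mul_of_nonneg_left (by linarith) (by linarith)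
  have hεε : ε₁ * (ε₁ * (M ^ (m + 1) + (N : ℝ) ^ (m + 1))) ≤
      1 / 8 * (ε₁ * (M ^ (m + 1) + (N : ℝ) ^ (m + 1))) :=
    mul_le_mul_of_nonneg_right hε8 (by positivity)
  have hεε0 : 0 ≤ ε₁ * (ε₁ * (M ^ (m + 1) + (N : ℝ) ^ (m + 1))) := by positivity
  have hεP : 0 ≤ ε₁ * M ^ (m + 1) := mul_nonneg hε0 hP0
  -- UPPER and LOWER
  have hU : S ^ (m + 1) ≤ (1 + 4 * ε₁) * M ^ (m + 1) := by linarith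
  have hL : (1 - 4 * ε₁) * M ^ (m + 1) ≤ S ^ (m + 1) := by linarith
  -- `(m+1)`-th roots with the gain `1/(m+1)`
  have h := uniformRoot_abs_sub_le (m + 1) (4 * ε₁) S M (by omega) (by positivity) (by linarith)
    hS hM hU hL
  calc |S - M| ≤ 2 * (4 * ε₁) / ((m + 1 : ℕ) : ℝ) * M := h
    _ = 8 * ε₁ / ((m : ℝ) + 1) * M := by push_cast; ring

/-! ### The schedule: the number of translates -/

/-- **The number of translates.** For `t ≥ 1` and `ℓ ≥ 2t` (`ℓ = log log N`), `m := ⌊ℓ^{t-1}⌋` satisfies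
`m ≥ 1`, `ℓ^{t-1} < m + 1` and `(m + 1) t ≤ (ℓ^{t-1} + 1) t ≤ 2 t ℓ^{t-1} ≤ ℓ^t`. [folklore] -/
theorem exists_translates {t : ℕ} (ht : 1 ≤ t) {ℓ : ℝ} (hℓ : 2 * (t : ℝ) ≤ ℓ) :
    ∃ m : ℕ, 1 ≤ m ∧ ℓ ^ (t - 1) < (m : ℝ) + 1 ∧ (((m + 1) * t : ℕ) : ℝ) ≤ ℓ ^ t := by
  have ht1 : (1 : ℝ) ≤ t := by exact_mod_cast ht
  have hℓ1 : 1 ≤ ℓ := by linarith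
  have hp1 : 1 ≤ ℓ ^ (t - 1) := one_le_pow₀ hℓ1
  refine ⟨⌊ℓ ^ (t - 1)⌋₊, (Nat.one_le_floor_iff _).2 hp1, Nat.lt_floor_add_one _, ?_⟩
  have hm : (⌊ℓ ^ (t - 1)⌋₊ : ℝ) ≤ ℓ ^ (t - 1) := Nat.floor_le (by positivity)
  push_cast
  calc ((⌊ℓ ^ (t - 1)⌋₊ : ℝ) + 1) * t ≤ (ℓ ^ (t - 1) + 1) * t :=
        mul_le_mul_of_nonneg_right (by linarith) (by positivity)
    _ ≤ (2 * ℓ ^ (t - 1)) * t := mul_le_mul_of_nonneg_right (by linarith) (by positivity)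
    _ = ℓ ^ (t - 1) * (2 * t) := by ring
    _ ≤ ℓ ^ (t - 1) * ℓ := mul_le_mul_of_nonneg_left hℓ (by positivity)
    _ = ℓ ^ t := by rw [← pow_succ, Nat.sub_add_cancel ht]

/-! ### The degenerate shifts contribute `o(N^{m+1})`, uniformly in the admissible `m` -/

/-- The numerics of the degenerate shifts for `m ≥ 1`: `(4N+1)^{m-1} (2N+1) ≤ 5^m N^m` (`N ≥ 1`). [folklore] -/
theorem pow_pred_mul_succ_le {m N : ℕ} (hm : 1 ≤ m) (hN : 1 ≤ N) :
    ((4 * N + 1 : ℕ) : ℝ) ^ (m - 1) * (2 * (N : ℝ) + 1) ≤ 5 ^ m * (N : ℝ) ^ m := by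
  obtain ⟨k, rfl⟩ : ∃ k, m = k + 1 := ⟨m - 1, by omega⟩
  rw [Nat.add_sub_cancel, ← mul_pow, pow_succ]
  have hN1 : (1 : ℝ) ≤ N := by exact_mod_cast hN
  have h1 : ((4 * N + 1 : ℕ) : ℝ) ≤ 5 * N := by push_cast; linarith
  have h2 : ((4 * N + 1 : ℕ) : ℝ) ^ k ≤ (5 * (N : ℝ)) ^ k := pow_le_pow_left₀ (by positivity) h1 k
  have h3 : 2 * (N : ℝ) + 1 ≤ 5 * N := by linarith
  exact mul_le_mul h2 h3 (by positivity) (by positivity)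

/-- **The junk inequality, uniform in `m`.** For `t ≥ 1`, `L₁ ≥ 1`, `ε₁ > 0` and all large `N`: for every `m`
with `(m+1) t ≤ (log log N)^t`,
`m(m+1)t² (4N+1)^{m-1} · (2N+1) log^{(m+1)t}(2 (3m+1) L₁ N) ≤ ε₁ N^{m+1}`
(`m(m+1)t² ≤ T²`, `(4N+1)^{m-1}(2N+1) ≤ 5^m N^m`, `log(2(3m+1)L₁N) ≤ 2 log N` as `8 T L₁ ≤ log N ≤ N`,
and `T², 5^m, 2^T, log^T N ≤ N^{1/8}`, `1/ε₁ ≤ N^{1/2}` by the uniform-growth toolkit, `T = (m+1)t`). [folklore] -/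
theorem eventually_degenerate_junk_le {t : ℕ} (ht : 1 ≤ t) {L₁ ε₁ : ℝ} (hL₁ : 1 ≤ L₁) (hε₁ : 0 < ε₁) :
    ∀ᶠ N : ℕ in atTop, ∀ m : ℕ, (((m + 1) * t : ℕ) : ℝ) ≤ Real.log (Real.log N) ^ t →
      (m : ℝ) * (m + 1) * (t : ℝ) ^ 2 * ((4 * N + 1 : ℕ) : ℝ) ^ (m - 1) *
          ((2 * (N : ℝ) + 1) * Real.log (2 * ((3 * (m : ℝ) + 1) * L₁) * N) ^ ((m + 1) * t)) ≤
        ε₁ * (N : ℝ) ^ (m + 1) := by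
  have h8 : (0 : ℝ) < 1 / 8 := by norm_num
  have hb : (1 : ℝ) ≤ max ε₁⁻¹ 1 := le_max_right _ _
  filter_upwards [eventually_natCast_pow_le_rpow t 2 1 h8,
    eventually_pow_le_rpow t (show (1 : ℝ) ≤ 5 by norm_num) 1 h8,
    eventually_pow_le_rpow t (show (1 : ℝ) ≤ 2 by norm_num) 1 h8, eventually_log_pow_le_rpow t 1 h8,
    eventually_pow_le_rpow 0 hb 1 (show (0 : ℝ) < 1 / 2 by norm_num),
    eventually_mul_loglog_pow_le t (8 * L₁) one_pos, eventually_ge_atTop 1] with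
    N hT2 h5m h2T hlogT hinv hLℓ hN1 m hm
  rcases Nat.eq_zero_or_pos m with rfl | hm1
  · simp only [Nat.cast_zero, zero_mul]
    positivity
  have hN1r : (1 : ℝ) ≤ N := by exact_mod_cast hN1
  have hN0 : (0 : ℝ) < N := by linarith
  have hL₁0 : 0 < L₁ := by linarith
  have hm0r : (0 : ℝ) ≤ m := Nat.cast_nonneg m
  set T := (m + 1) * t with hTdef
  have hm' : (T : ℝ) ≤ 1 * Real.log (Real.log N) ^ t := by rw [one_mul]; exact hm
  have hT1 : 1 ≤ T := le_trans ht (Nat.le_mul_of_pos_left t (Nat.succ_pos m))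
  have hmT : m ≤ T := (Nat.le_succ m).trans (Nat.le_mul_of_pos_right _ ht)
  have hmTr : (m : ℝ) ≤ T := by exact_mod_cast hmT
  have hT1r : (1 : ℝ) ≤ T := by exact_mod_cast hT1
  -- the five junk factors
  have A1 : (T : ℝ) ^ 2 ≤ (N : ℝ) ^ (1 / 8 : ℝ) := hT2 T hm'
  have A2 : (5 : ℝ) ^ m ≤ (N : ℝ) ^ (1 / 8 : ℝ) := h5m m (hmTr.trans hm')
  have A3 : (2 : ℝ) ^ T ≤ (N : ℝ) ^ (1 / 8 : ℝ) := h2T T hm'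
  have A4 : Real.log N ^ T ≤ (N : ℝ) ^ (1 / 8 : ℝ) := hlogT T hm'
  have A5 : ε₁⁻¹ ≤ (N : ℝ) ^ (1 / 2 : ℝ) := by
    have h := hinv 1 (by simp)
    rw [pow_one] at h
    exact (le_max_left _ _).trans h
  -- `m(m+1)t² ≤ T²`
  have hCD : (m : ℝ) * (m + 1) * (t : ℝ) ^ 2 ≤ (T : ℝ) ^ 2 := by
    rw [hTdef]
    push_cast
    have hm0 : (0 : ℝ) ≤ m := Nat.cast_nonneg m
    have ht0 : (0 : ℝ) ≤ (t : ℝ) ^ 2 := sq_nonneg _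
    calc (m : ℝ) * (m + 1) * (t : ℝ) ^ 2 ≤ (m + 1) * (m + 1) * (t : ℝ) ^ 2 :=
          mul_le_mul_of_nonneg_right (mul_le_mul_of_nonneg_right (by linarith) (by linarith)) ht0
      _ = ((m + 1) * t) ^ 2 := by ring
  -- `(4N+1)^{m-1} (2N+1) ≤ 5^m N^m`
  have h45 := pow_pred_mul_succ_le hm1 hN1
  -- `log(2 (3m+1) L₁ N) ≤ 2 log N`
  have hc1 : 1 ≤ 2 * ((3 * (m : ℝ) + 1) * L₁) := by nlinarith
  have hlog0 : 0 ≤ Real.log (2 * ((3 * (m : ℝ) + 1) * L₁) * N) := Real.log_nonneg (by nlinarith)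
  have hlog : Real.log (2 * ((3 * (m : ℝ) + 1) * L₁) * N) ≤ 2 * Real.log N := by
    have h1 : 2 * ((3 * (m : ℝ) + 1) * L₁) ≤ N :=
      calc 2 * ((3 * (m : ℝ) + 1) * L₁) ≤ 2 * ((4 * T) * L₁) := by
            refine mul_le_mul_of_nonneg_left ?_ (by norm_num)
            exact mul_le_mul_of_nonneg_right (by linarith) hL₁0.le
        _ = 8 * L₁ * T := by ring
        _ ≤ 8 * L₁ * Real.log (Real.log N) ^ t := mul_le_mul_of_nonneg_left hm (by positivity)
        _ ≤ 1 * Real.log N := hLℓ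
        _ ≤ N := by rw [one_mul]; exact Real.log_le_self hN0.le
    have hpos : 0 < 2 * ((3 * (m : ℝ) + 1) * L₁) * N := by positivity
    calc Real.log (2 * ((3 * (m : ℝ) + 1) * L₁) * N) ≤ Real.log (N * N) :=
          Real.log_le_log hpos (mul_le_mul_of_nonneg_right h1 hN0.le)
      _ = 2 * Real.log N := by rw [Real.log_mul hN0.ne' hN0.ne']; ring
  have hlogpow : Real.log (2 * ((3 * (m : ℝ) + 1) * L₁) * N) ^ T ≤
      (N : ℝ) ^ (1 / 8 : ℝ) * (N : ℝ) ^ (1 / 8 : ℝ) :=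
    calc Real.log (2 * ((3 * (m : ℝ) + 1) * L₁) * N) ^ T ≤ (2 * Real.log N) ^ T :=
          pow_le_pow_left₀ hlog0 hlog T
      _ = 2 ^ T * Real.log N ^ T := mul_pow _ _ _
      _ ≤ (N : ℝ) ^ (1 / 8 : ℝ) * (N : ℝ) ^ (1 / 8 : ℝ) :=
          mul_le_mul A3 A4 (pow_nonneg (Real.log_nonneg hN1r) T) (by positivity)
  -- assemble
  have hX4 : (N : ℝ) ^ (1 / 8 : ℝ) * (N : ℝ) ^ (1 / 8 : ℝ) * ((N : ℝ) ^ (1 / 8 : ℝ) * (N : ℝ) ^ (1 / 8 : ℝ)) =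
      (N : ℝ) ^ (1 / 2 : ℝ) := by
    rw [← Real.rpow_add hN0, ← Real.rpow_add hN0]
    norm_num
  have hhalf : (N : ℝ) ^ (1 / 2 : ℝ) * (N : ℝ) ^ (1 / 2 : ℝ) = N := by
    rw [← Real.rpow_add hN0]
    norm_num
  have hεN : 1 ≤ ε₁ * (N : ℝ) ^ (1 / 2 : ℝ) := by
    have h := mul_le_mul_of_nonneg_left A5 hε₁.le
    rwa [mul_inv_cancel₀ hε₁.ne'] at h
  have hXm0 : 0 ≤ (N : ℝ) ^ (1 / 2 : ℝ) * (N : ℝ) ^ m := by positivity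
  calc (m : ℝ) * (m + 1) * (t : ℝ) ^ 2 * ((4 * N + 1 : ℕ) : ℝ) ^ (m - 1) *
        ((2 * (N : ℝ) + 1) * Real.log (2 * ((3 * (m : ℝ) + 1) * L₁) * N) ^ T)
      = (m : ℝ) * (m + 1) * (t : ℝ) ^ 2 * (((4 * N + 1 : ℕ) : ℝ) ^ (m - 1) * (2 * (N : ℝ) + 1)) *
          Real.log (2 * ((3 * (m : ℝ) + 1) * L₁) * N) ^ T := by ring
    _ ≤ (T : ℝ) ^ 2 * (5 ^ m * (N : ℝ) ^ m) * ((N : ℝ) ^ (1 / 8 : ℝ) * (N : ℝ) ^ (1 / 8 : ℝ)) :=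
        mul_le_mul (mul_le_mul hCD h45 (by positivity) (by positivity)) hlogpow (pow_nonneg hlog0 T)
          (by positivity)
    _ ≤ (N : ℝ) ^ (1 / 8 : ℝ) * ((N : ℝ) ^ (1 / 8 : ℝ) * (N : ℝ) ^ m) *
          ((N : ℝ) ^ (1 / 8 : ℝ) * (N : ℝ) ^ (1 / 8 : ℝ)) := by
        apply mul_le_mul_of_nonneg_right _ (by positivity)
        exact mul_le_mul A1 (mul_le_mul_of_nonneg_right A2 (by positivity)) (by positivity)
          (by positivity)
    _ = (N : ℝ) ^ (1 / 2 : ℝ) * (N : ℝ) ^ m := by rw [← hX4]; ring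
    _ ≤ (N : ℝ) ^ (1 / 2 : ℝ) * (N : ℝ) ^ m * (ε₁ * (N : ℝ) ^ (1 / 2 : ℝ)) :=
        le_mul_of_one_le_right hXm0 hεN
    _ = ε₁ * ((N : ℝ) ^ (1 / 2 : ℝ) * (N : ℝ) ^ (1 / 2 : ℝ)) * (N : ℝ) ^ m := by ring
    _ = ε₁ * (N : ℝ) ^ (m + 1) := by rw [hhalf]; ring

end Summit.Parity.GeneralizedHardyLittlewood.Cruxes.AbsoluteUpgrade.UniformAmplification

end
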